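import Summits.CriticalPhenomena.PercolationContinuityZ3.Theses.PercNearOneGluing
import Summits.CriticalPhenomena.PercolationContinuityZ3.Theorems.PercNearOneGluingAdditiveGluingEngineFull
import HarnessLib

/-! # Crux `PercNearOneGluing.AdditiveGluing` (stmt-CriticalPhenomena-4576) — the Q9 LINE, part II: designated ("Question 9") goodness
# inducted over the full star, and `AdditiveGluing` BY NAME from the residual kernel WITH the Q9 induction hypothesis (invested seat xfam-a)

Lands `--supports stmt-CriticalPhenomena-4576`; no definitions, no named facts.  Everything is stated inline:
* `Q9(w, A, o, b)`: for EVERY minimiser `a₀` of `μ_K(· ↔ b)` over `A` (`K` = `w` with the star of `o` killed) and every selection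
  `sel W ∈ A`,  `μ_w(a₀ ↔ b) ≤ μ_w(o ↔ b) + Σ_{W ∋ o, W ∩ A = ∅} μ_w(C(o) = W)·μ_w(sel W ↔ b in Wᶜ)`.  It implies the skeleton's goodness
  (`good_of_q9`, via `goodStep24_good_of_engine`) and is PRESERVED by the σ-decomposition of the full star (part I, `engineFull`).
* `q9Step_of_residualKernelQ9`: the inductive step of Q9 from `hres9` = the official residual kernel (bad block, `|S| ≥ 2`, `4 ≤ A.card`,
  drift) WITH the Q9 induction hypothesis for every weighting with at most as many positive-degree vertices as the glued block graph:
  layers meeting `A` by KN Lemma 5 (`stub_gluingLemma5`) or trivially (`b ∈ S`), the empty layer by `goodStep24_ker_empty`, singleton bad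
  layers by the Q9 hypothesis for `K` observed from `y` (initial segment + the switching leaf `blockKernel_of_designated`), good blocks by
  `blockGood_leaf_lemma5`, `A.card ≤ 3` by the drift theorem `blockGood_cardLeThree`, drift-free blocks by `blockGood_leaf_ih` + `good_of_q9`.
* `q9All_of_residualKernelQ9` (strong induction on the number of positive-degree vertices; NO base case: an observer without low
  neighbours has only layers meeting `A`) and `additiveGluing_of_residualKernelQ9 : hres9 → AdditiveGluing` (the level-set composition of
  the skeleton `Lines/subuniform_dead_pocket_maximum.lean`, verbatim).
With `hres9` the residual may use the SWITCHING leaf fed by the Q9 hypothesis for the glued block observed from one of its own vertices,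
which numerically completes the leaf set at n ≤ 8 (seat note `Cruxes/AdditiveGluing/XfamA-Q9-residual.md` §4).
[cite: KozmaNitzan2024, §3.2 (Definition p. 12, Lemma 5 p. 13, Thms 4–5 pp. 12–14), Question 9 (p. 36)]
-/

namespace Summit.CriticalPhenomena.PercolationContinuityZ3.Theorems

open MeasureTheory Set
open Literature.Probability.LatticeModels (prodBernoulli)
open Literature.Probability.Percolation (BondConfig openConn openConnIn openGraph openCluster)
open scoped BigOperators

noncomputable section
open Classical

section Q9Step

open Filter
open Literature.Probability.LatticeModels Literature.Probability.Percolation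

variable {n : ℕ}

/-- **Q9 goodness implies goodness** (selection form, all levels): take the tightest level at a minimiser of `μ_K(· ↔ b)`.
[cite: KozmaNitzan2024, §3.2 (Definition p. 12)] -/
theorem good_of_q9 (u : Sym2 (Fin n) → unitInterval) (A : Finset (Fin n)) (o b : Fin n) (hb : b ∈ A)
    (hQ : ∀ a₀ : Fin n, a₀ ∈ A →
        (∀ a ∈ A, (prodBernoulli (fun e : Sym2 (Fin n) => if o ∈ e then (0 : unitInterval) else u e)).real (openConn a₀ b) ≤
          (prodBernoulli (fun e : Sym2 (Fin n) => if o ∈ e then (0 : unitInterval) else u e)).real (openConn a b)) →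
        ∀ sel : Finset (Fin n) → Fin n, (∀ W, sel W ∈ A) →
        (prodBernoulli u).real (openConn a₀ b) ≤
          (prodBernoulli u).real (openConn o b)
            + ∑ W ∈ (Finset.univ : Finset (Finset (Fin n))).filter (fun W => o ∈ W ∧ Disjoint W A),
                (prodBernoulli u).real {ω : BondConfig (Fin n) | openCluster ω o = (W : Set (Fin n))}
                  * (prodBernoulli u).real (openConnIn ((W : Set (Fin n))ᶜ) (sel W) b)) :
    ∀ (t : ℝ) (sel : Finset (Fin n) → Fin n), (∀ W, sel W ∈ A) →
      (∀ a ∈ A, 1 - t ≤ (prodBernoulli u).real (openConn a b)) →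
      (prodBernoulli u).real ((⋃ a ∈ A, openConn o a) ∩ (openConn o b)ᶜ)
        + ∑ W ∈ (Finset.univ : Finset (Finset (Fin n))).filter (fun W => o ∈ W ∧ Disjoint W A),
            (prodBernoulli u).real {ω : BondConfig (Fin n) | openCluster ω o = (W : Set (Fin n))}
              * (prodBernoulli u).real (openConnIn ((W : Set (Fin n))ᶜ) (sel W) b)ᶜ ≤ t := by
  intro t sel hsel ht
  obtain ⟨a₀, ha₀, hmin⟩ := Finset.exists_min_image A
    (fun a => (prodBernoulli (fun e : Sym2 (Fin n) => if o ∈ e then (0 : unitInterval) else u e)).real (openConn a b)) ⟨b, hb⟩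
  exact goodStep24_good_of_engine u A o b a₀ sel hb ha₀ t ht (hQ a₀ ha₀ hmin sel hsel)

end Q9Step

/-- **The inductive step of Q9 goodness from the residual kernel WITH the Q9 induction hypothesis.**  See the module docstring.
[cite: KozmaNitzan2024, §3.2 (Lemma 5 p. 13, Thms 4–5 pp. 12–14), Question 9 (p. 36)] -/
theorem q9Step_of_residualKernelQ9
    (hres9 : ∀ (n : ℕ) (u : Sym2 (Fin n) → unitInterval) (A S : Finset (Fin n)) (b a₀ : Fin n)
      (sel : Finset (Fin n) → Fin n),
      b ∈ A → Disjoint S A → 2 ≤ S.card → 4 ≤ A.card → (∀ W, sel W ∈ A) → a₀ ∈ A →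
      (∀ a ∈ A, (prodBernoulli u).real (openConn a₀ b) ≤ (prodBernoulli u).real (openConn a b)) →
      (∀ v ∈ S, (prodBernoulli u).real (openConn v b) < (prodBernoulli u).real (openConn a₀ b)) →
      (∃ a ∈ A, (prodBernoulli (fun e : Sym2 (Fin n) => if (∀ x ∈ e, x ∈ S) ∧ ¬ e.IsDiag then 1 else u e)).real (openConn a b) <
        (prodBernoulli (fun e : Sym2 (Fin n) => if (∀ x ∈ e, x ∈ S) ∧ ¬ e.IsDiag then 1 else u e)).real (openConn a₀ b)) →
      (∀ w' : Sym2 (Fin n) → unitInterval,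
        (Finset.univ.filter (fun v : Fin n => ∃ z : Fin n, 0 < (w' s(z, v) : ℝ))).card ≤
          (Finset.univ.filter (fun v : Fin n => ∃ z : Fin n,
            0 < ((fun e : Sym2 (Fin n) => if (∀ x ∈ e, x ∈ S) ∧ ¬ e.IsDiag then 1 else u e) s(z, v) : ℝ))).card →
        ∀ (A' : Finset (Fin n)) (o' b' : Fin n), b' ∈ A' → o' ∉ A' →
        ∀ c₀ : Fin n, c₀ ∈ A' →
          (∀ c ∈ A', (prodBernoulli (fun e : Sym2 (Fin n) => if o' ∈ e then (0 : unitInterval) else w' e)).real (openConn c₀ b') ≤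
            (prodBernoulli (fun e : Sym2 (Fin n) => if o' ∈ e then (0 : unitInterval) else w' e)).real (openConn c b')) →
          ∀ sel' : Finset (Fin n) → Fin n, (∀ W', sel' W' ∈ A') →
          (prodBernoulli w').real (openConn c₀ b') ≤
            (prodBernoulli w').real (openConn o' b')
              + ∑ W' ∈ (Finset.univ : Finset (Finset (Fin n))).filter (fun W' => o' ∈ W' ∧ Disjoint W' A'),
                  (prodBernoulli w').real {ω : BondConfig (Fin n) | openCluster ω o' = (W' : Set (Fin n))}
                    * (prodBernoulli w').real (openConnIn ((W' : Set (Fin n))ᶜ) (sel' W') b')) →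
      (prodBernoulli u).real (openConn a₀ b)
          + (prodBernoulli u).real ((openConn a₀ b)ᶜ ∩ (⋃ s ∈ S, openConn a₀ s) ∩ (⋃ s ∈ S, openConn s b))
        ≤ (prodBernoulli u).real (⋃ s ∈ S, openConn s b)
          + ∑ W ∈ (Finset.univ : Finset (Finset (Fin n))).filter (fun W => Disjoint W A),
              (prodBernoulli u).real {ω : BondConfig (Fin n) | ∀ z : Fin n, (z ∈ W ↔ ω ∈ ⋃ s ∈ S, openConn s z)}
                * (prodBernoulli u).real (openConnIn ((W : Set (Fin n))ᶜ) (sel W) b)) :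
    ∀ (n : ℕ) (w : Sym2 (Fin n) → unitInterval) (A : Finset (Fin n)) (o b : Fin n),
      b ∈ A → o ∉ A →
      (∀ w' : Sym2 (Fin n) → unitInterval,
        (Finset.univ.filter (fun v : Fin n => ∃ z : Fin n, 0 < (w' s(z, v) : ℝ))).card < (Finset.univ.filter (fun v : Fin n => ∃ z : Fin n, 0 < (w s(z, v) : ℝ))).card →
        ∀ (A' : Finset (Fin n)) (o' b' : Fin n), b' ∈ A' → o' ∉ A' →
        ∀ c₀ : Fin n, c₀ ∈ A' →
          (∀ c ∈ A', (prodBernoulli (fun e : Sym2 (Fin n) => if o' ∈ e then (0 : unitInterval) else w' e)).real (openConn c₀ b') ≤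
            (prodBernoulli (fun e : Sym2 (Fin n) => if o' ∈ e then (0 : unitInterval) else w' e)).real (openConn c b')) →
          ∀ sel' : Finset (Fin n) → Fin n, (∀ W', sel' W' ∈ A') →
          (prodBernoulli w').real (openConn c₀ b') ≤
            (prodBernoulli w').real (openConn o' b')
              + ∑ W' ∈ (Finset.univ : Finset (Finset (Fin n))).filter (fun W' => o' ∈ W' ∧ Disjoint W' A'),
                  (prodBernoulli w').real {ω : BondConfig (Fin n) | openCluster ω o' = (W' : Set (Fin n))}
                    * (prodBernoulli w').real (openConnIn ((W' : Set (Fin n))ᶜ) (sel' W') b')) →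
      ∀ a₀ : Fin n, a₀ ∈ A →
        (∀ a ∈ A, (prodBernoulli (fun e : Sym2 (Fin n) => if o ∈ e then (0 : unitInterval) else w e)).real (openConn a₀ b) ≤
          (prodBernoulli (fun e : Sym2 (Fin n) => if o ∈ e then (0 : unitInterval) else w e)).real (openConn a b)) →
        ∀ sel : Finset (Fin n) → Fin n, (∀ W, sel W ∈ A) →
        (prodBernoulli w).real (openConn a₀ b) ≤
          (prodBernoulli w).real (openConn o b)
            + ∑ W ∈ (Finset.univ : Finset (Finset (Fin n))).filter (fun W => o ∈ W ∧ Disjoint W A),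
                (prodBernoulli w).real {ω : BondConfig (Fin n) | openCluster ω o = (W : Set (Fin n))}
                  * (prodBernoulli w).real (openConnIn ((W : Set (Fin n))ᶜ) (sel W) b) := by
  intro n w A o b hb ho IH9 a₀ ha₀ hmin sel hsel
  set K : Sym2 (Fin n) → unitInterval := fun e => if o ∈ e then (0 : unitInterval) else w e with hKdef
  have hKo : ∀ z : Fin n, K s(o, z) = 0 := fun z => by
    simp only [hKdef]
    rw [if_pos (Sym2.mem_mk_left o z)]
  have hKw : ∀ e : Sym2 (Fin n), o ∉ e → K e = w e := by
    intro e hoe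
    simp only [hKdef]
    rw [if_neg hoe]
  refine engineFull w A o b a₀ sel hb ho ha₀ ?_
  intro S hoS hSw
  rw [engineFull_branch_weight_eq w S o]
  have hSw' : ∀ y ∈ S, (w s(o, y) : ℝ) ≠ 0 := fun y hy h => hSw y hy (Subtype.ext h)
  by_cases hSA : Disjoint S A
  swap
  · -- a layer meeting `A`
    obtain ⟨a, haS, haA⟩ := Finset.not_disjoint_iff.1 hSA
    by_cases hbS : b ∈ S
    · have h1 : (prodBernoulli (fun e : Sym2 (Fin n) =>
          if (∀ x ∈ e, x ∈ S) ∧ ¬ e.IsDiag then 1 else K e)).real (⋃ s ∈ S, openConn s b) = 1 := by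
        have : (⋃ s ∈ S, (openConn s b : Set (BondConfig (Fin n)))) = Set.univ :=
          Set.eq_univ_of_forall fun ω => Set.mem_iUnion₂.2
            ⟨b, hbS, (SimpleGraph.Reachable.refl b : (openGraph ω).Reachable b b)⟩
        rw [this, probReal_univ]
      rw [h1]
      exact measureReal_le_one.trans (le_add_of_nonneg_right (Finset.sum_nonneg fun _ _ =>
        mul_nonneg measureReal_nonneg measureReal_nonneg))
    · exact (stub_gluingLemma5 n K S a₀ a b haS hbS (hmin a haA)).trans
        (le_add_of_nonneg_right (Finset.sum_nonneg fun _ _ =>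
          mul_nonneg measureReal_nonneg measureReal_nonneg))
  · -- a layer avoiding `A`
    rcases S.eq_empty_or_nonempty with rfl | hSne
    · rw [goodStep24_glue_empty K]
      refine goodStep24_ker_empty w K A o b a₀ sel ho hsel hmin (fun e he => ?_) fun z _ => hKo z
      refine (hKw e fun hoe => ?_).symm
      exact (Set.mk_mem_sym2_iff.1 (show s(o, o) ∈ (({o} : Set (Fin n))ᶜ).sym2 from by
        induction e using Sym2.ind with
        | h x y =>
          have hx := (Set.mk_mem_sym2_iff.1 he).1
          have hy := (Set.mk_mem_sym2_iff.1 he).2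
          rcases Sym2.mem_iff.1 hoe with rfl | rfl
          · exact absurd rfl hx
          · exact absurd rfl hy)).1 rfl
    refine stub_goodStepBranch_k24 n w K A S o b a₀ sel ho hoS hsel hKo hKw ?_
    rw [blockGrowth_glue_real_openConn, blockGrowth_glue_real_iUnion K S b]
    simp only [blockGrowth_glue_real_pocket K S]
    obtain ⟨s₀, hs₀⟩ := hSne
    have hs₀A : s₀ ∉ A := Finset.disjoint_left.1 hSA hs₀
    have hbS : b ∉ S := fun h => Finset.disjoint_left.1 hSA h hb
    have hcardK := goodStep24_card_lt w o s₀ (hSw' s₀ hs₀)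
    have hcardG := driftFree_card_lt w S o s₀ hoS (hSw' s₀ hs₀) hSw
    by_cases hS1 : S.card = 1
    · -- a singleton bad layer: the Q9 hypothesis for `K` observed from `y`, initial segment, switching leaf
      obtain ⟨y, rfl⟩ := Finset.card_eq_one.1 hS1
      have hyA : y ∉ A := Finset.disjoint_singleton_left.1 hSA
      have hQ := IH9 K hcardK A y b hb hyA
      obtain ⟨a', ha', hmin'⟩ := Finset.exists_min_image A
        (fun a => (prodBernoulli (fun e : Sym2 (Fin n) => if y ∈ e then (0 : unitInterval) else K e)).real
          (openConn a b)) ⟨b, hb⟩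
      have hdes := hQ a' ha' hmin' (fun W' => sel (insert o W')) (fun W' => hsel _)
      refine blockKernel_of_designated K A {y} b a₀ a' y (fun W' => sel (insert o W'))
        (Finset.mem_singleton_self y) ?_ ?_
      · rw [goodStep24_glue_singleton K y]
        exact hmin a' ha'
      · rw [goodStep24_glue_singleton K y]
        exact hdes
    · have h2 : 2 ≤ S.card := by
        have h1 := Finset.card_pos.2 ⟨s₀, hs₀⟩
        omega
      by_cases hgood : ∃ v ∈ S, (prodBernoulli K).real (openConn a₀ b) ≤ (prodBernoulli K).real (openConn v b)
      · obtain ⟨v, hvS, hle⟩ := hgood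
        exact blockGood_leaf_lemma5 K A S b a₀ v _ hvS hbS hle
      · push Not at hgood
        by_cases hA3 : A.card ≤ 3
        · exact blockGood_cardLeThree K A S b a₀ (fun W' => sel (insert o W')) hb ha₀ hA3 ⟨s₀, hs₀⟩
            (fun W' => hsel _) hmin
        by_cases hfree : ∀ a ∈ A, (prodBernoulli (fun e : Sym2 (Fin n) =>
            if (∀ x ∈ e, x ∈ S) ∧ ¬ e.IsDiag then 1 else K e)).real (openConn a₀ b) ≤
          (prodBernoulli (fun e : Sym2 (Fin n) => if (∀ x ∈ e, x ∈ S) ∧ ¬ e.IsDiag then 1 else K e)).real (openConn a b)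
        · -- no drift: the IH leaf, goodness of the glued quadruple from its Q9 goodness
          have hQg := IH9 (fun e : Sym2 (Fin n) => if (∀ x ∈ e, x ∈ S) ∧ ¬ e.IsDiag then 1 else K e) hcardG A s₀ b
            hb hs₀A
          exact blockGood_leaf_ih K A S b a₀ s₀ (fun W' => sel (insert o W')) hs₀ hb (fun W' => hsel _) hfree
            (good_of_q9 _ A s₀ b hb hQg)
        · -- the residue
          push Not at hA3 hfree
          obtain ⟨a, ha, hlt⟩ := hfree
          exact hres9 n K A S b a₀ (fun W' => sel (insert o W')) hb hSA h2 (by omega) (fun W' => hsel _) ha₀ hmin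
            hgood ⟨a, ha, hlt⟩ (fun w' hw' A' o' b' hb' ho' =>
              IH9 w' (lt_of_le_of_lt hw' hcardG) A' o' b' hb' ho')

/-- **Q9 goodness of every quadruple from the residual kernel with the Q9 induction hypothesis**: strong induction on the number of
positive-degree vertices; no base case (`q9Step_of_residualKernelQ9` needs none). [cite: KozmaNitzan2024, §3.2 (Thms 4–5 pp. 12–14)] -/
theorem q9All_of_residualKernelQ9
    (hres9 : ∀ (n : ℕ) (u : Sym2 (Fin n) → unitInterval) (A S : Finset (Fin n)) (b a₀ : Fin n)
      (sel : Finset (Fin n) → Fin n),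
      b ∈ A → Disjoint S A → 2 ≤ S.card → 4 ≤ A.card → (∀ W, sel W ∈ A) → a₀ ∈ A →
      (∀ a ∈ A, (prodBernoulli u).real (openConn a₀ b) ≤ (prodBernoulli u).real (openConn a b)) →
      (∀ v ∈ S, (prodBernoulli u).real (openConn v b) < (prodBernoulli u).real (openConn a₀ b)) →
      (∃ a ∈ A, (prodBernoulli (fun e : Sym2 (Fin n) => if (∀ x ∈ e, x ∈ S) ∧ ¬ e.IsDiag then 1 else u e)).real (openConn a b) <
        (prodBernoulli (fun e : Sym2 (Fin n) => if (∀ x ∈ e, x ∈ S) ∧ ¬ e.IsDiag then 1 else u e)).real (openConn a₀ b)) →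
      (∀ w' : Sym2 (Fin n) → unitInterval,
        (Finset.univ.filter (fun v : Fin n => ∃ z : Fin n, 0 < (w' s(z, v) : ℝ))).card ≤
          (Finset.univ.filter (fun v : Fin n => ∃ z : Fin n,
            0 < ((fun e : Sym2 (Fin n) => if (∀ x ∈ e, x ∈ S) ∧ ¬ e.IsDiag then 1 else u e) s(z, v) : ℝ))).card →
        ∀ (A' : Finset (Fin n)) (o' b' : Fin n), b' ∈ A' → o' ∉ A' →
        ∀ c₀ : Fin n, c₀ ∈ A' →
          (∀ c ∈ A', (prodBernoulli (fun e : Sym2 (Fin n) => if o' ∈ e then (0 : unitInterval) else w' e)).real (openConn c₀ b') ≤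
            (prodBernoulli (fun e : Sym2 (Fin n) => if o' ∈ e then (0 : unitInterval) else w' e)).real (openConn c b')) →
          ∀ sel' : Finset (Fin n) → Fin n, (∀ W', sel' W' ∈ A') →
          (prodBernoulli w').real (openConn c₀ b') ≤
            (prodBernoulli w').real (openConn o' b')
              + ∑ W' ∈ (Finset.univ : Finset (Finset (Fin n))).filter (fun W' => o' ∈ W' ∧ Disjoint W' A'),
                  (prodBernoulli w').real {ω : BondConfig (Fin n) | openCluster ω o' = (W' : Set (Fin n))}
                    * (prodBernoulli w').real (openConnIn ((W' : Set (Fin n))ᶜ) (sel' W') b')) →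
      (prodBernoulli u).real (openConn a₀ b)
          + (prodBernoulli u).real ((openConn a₀ b)ᶜ ∩ (⋃ s ∈ S, openConn a₀ s) ∩ (⋃ s ∈ S, openConn s b))
        ≤ (prodBernoulli u).real (⋃ s ∈ S, openConn s b)
          + ∑ W ∈ (Finset.univ : Finset (Finset (Fin n))).filter (fun W => Disjoint W A),
              (prodBernoulli u).real {ω : BondConfig (Fin n) | ∀ z : Fin n, (z ∈ W ↔ ω ∈ ⋃ s ∈ S, openConn s z)}
                * (prodBernoulli u).real (openConnIn ((W : Set (Fin n))ᶜ) (sel W) b)) :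
    ∀ (n : ℕ) (w : Sym2 (Fin n) → unitInterval) (A : Finset (Fin n)) (o b : Fin n),
      b ∈ A → o ∉ A →
      ∀ a₀ : Fin n, a₀ ∈ A →
        (∀ a ∈ A, (prodBernoulli (fun e : Sym2 (Fin n) => if o ∈ e then (0 : unitInterval) else w e)).real (openConn a₀ b) ≤
          (prodBernoulli (fun e : Sym2 (Fin n) => if o ∈ e then (0 : unitInterval) else w e)).real (openConn a b)) →
        ∀ sel : Finset (Fin n) → Fin n, (∀ W, sel W ∈ A) →
        (prodBernoulli w).real (openConn a₀ b) ≤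
          (prodBernoulli w).real (openConn o b)
            + ∑ W ∈ (Finset.univ : Finset (Finset (Fin n))).filter (fun W => o ∈ W ∧ Disjoint W A),
                (prodBernoulli w).real {ω : BondConfig (Fin n) | openCluster ω o = (W : Set (Fin n))}
                  * (prodBernoulli w).real (openConnIn ((W : Set (Fin n))ᶜ) (sel W) b) := by
  intro n
  suffices h : ∀ (k : ℕ) (w : Sym2 (Fin n) → unitInterval),
      (Finset.univ.filter (fun v : Fin n => ∃ z : Fin n, 0 < (w s(z, v) : ℝ))).card = k →
      ∀ (A : Finset (Fin n)) (o b : Fin n), b ∈ A → o ∉ A →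
      ∀ a₀ : Fin n, a₀ ∈ A →
        (∀ a ∈ A, (prodBernoulli (fun e : Sym2 (Fin n) => if o ∈ e then (0 : unitInterval) else w e)).real (openConn a₀ b) ≤
          (prodBernoulli (fun e : Sym2 (Fin n) => if o ∈ e then (0 : unitInterval) else w e)).real (openConn a b)) →
        ∀ sel : Finset (Fin n) → Fin n, (∀ W, sel W ∈ A) →
        (prodBernoulli w).real (openConn a₀ b) ≤
          (prodBernoulli w).real (openConn o b)
            + ∑ W ∈ (Finset.univ : Finset (Finset (Fin n))).filter (fun W => o ∈ W ∧ Disjoint W A),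
                (prodBernoulli w).real {ω : BondConfig (Fin n) | openCluster ω o = (W : Set (Fin n))}
                  * (prodBernoulli w).real (openConnIn ((W : Set (Fin n))ᶜ) (sel W) b) by
    intro w A o b hb ho
    exact h _ w rfl A o b hb ho
  intro k
  induction k using Nat.strong_induction_on with
  | _ k ih =>
    intro w hk A o b hb ho
    refine q9Step_of_residualKernelQ9 hres9 n w A o b hb ho ?_
    intro w' hw' A' o' b' hb' ho'
    exact ih _ (hk ▸ hw') w' rfl A' o' b' hb' ho'

/-- **`AdditiveGluing` from the residual kernel WITH the Q9 induction hypothesis** — the crux BY NAME.  The level-set composition of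
the skeleton `Lines/subuniform_dead_pocket_maximum.lean` (`AdditiveGluing_of`, verbatim) on top of `q9All_of_residualKernelQ9` and
`good_of_q9`: if `t ≥ 1` the claim is trivial; otherwise pass to the level set `A' = {x | 1 − t ≤ τ(x)} ∋ b`; if `o ∈ A'` then
`μ(o ↔ A) − t ≤ 1 − t ≤ τ(o)`; else goodness of `(w, A', o, b)` with the constant selection `b` bounds the live failure by `t`.
[cite: KozmaNitzan2024, §3.2 (Definition p. 12, Thms 4–5 pp. 12–14)] -/
theorem additiveGluing_of_residualKernelQ9
    (hres9 : ∀ (n : ℕ) (u : Sym2 (Fin n) → unitInterval) (A S : Finset (Fin n)) (b a₀ : Fin n)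
      (sel : Finset (Fin n) → Fin n),
      b ∈ A → Disjoint S A → 2 ≤ S.card → 4 ≤ A.card → (∀ W, sel W ∈ A) → a₀ ∈ A →
      (∀ a ∈ A, (prodBernoulli u).real (openConn a₀ b) ≤ (prodBernoulli u).real (openConn a b)) →
      (∀ v ∈ S, (prodBernoulli u).real (openConn v b) < (prodBernoulli u).real (openConn a₀ b)) →
      (∃ a ∈ A, (prodBernoulli (fun e : Sym2 (Fin n) => if (∀ x ∈ e, x ∈ S) ∧ ¬ e.IsDiag then 1 else u e)).real (openConn a b) <
        (prodBernoulli (fun e : Sym2 (Fin n) => if (∀ x ∈ e, x ∈ S) ∧ ¬ e.IsDiag then 1 else u e)).real (openConn a₀ b)) →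
      (∀ w' : Sym2 (Fin n) → unitInterval,
        (Finset.univ.filter (fun v : Fin n => ∃ z : Fin n, 0 < (w' s(z, v) : ℝ))).card ≤
          (Finset.univ.filter (fun v : Fin n => ∃ z : Fin n,
            0 < ((fun e : Sym2 (Fin n) => if (∀ x ∈ e, x ∈ S) ∧ ¬ e.IsDiag then 1 else u e) s(z, v) : ℝ))).card →
        ∀ (A' : Finset (Fin n)) (o' b' : Fin n), b' ∈ A' → o' ∉ A' →
        ∀ c₀ : Fin n, c₀ ∈ A' →
          (∀ c ∈ A', (prodBernoulli (fun e : Sym2 (Fin n) => if o' ∈ e then (0 : unitInterval) else w' e)).real (openConn c₀ b') ≤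
            (prodBernoulli (fun e : Sym2 (Fin n) => if o' ∈ e then (0 : unitInterval) else w' e)).real (openConn c b')) →
          ∀ sel' : Finset (Fin n) → Fin n, (∀ W', sel' W' ∈ A') →
          (prodBernoulli w').real (openConn c₀ b') ≤
            (prodBernoulli w').real (openConn o' b')
              + ∑ W' ∈ (Finset.univ : Finset (Finset (Fin n))).filter (fun W' => o' ∈ W' ∧ Disjoint W' A'),
                  (prodBernoulli w').real {ω : BondConfig (Fin n) | openCluster ω o' = (W' : Set (Fin n))}
                    * (prodBernoulli w').real (openConnIn ((W' : Set (Fin n))ᶜ) (sel' W') b')) →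
      (prodBernoulli u).real (openConn a₀ b)
          + (prodBernoulli u).real ((openConn a₀ b)ᶜ ∩ (⋃ s ∈ S, openConn a₀ s) ∩ (⋃ s ∈ S, openConn s b))
        ≤ (prodBernoulli u).real (⋃ s ∈ S, openConn s b)
          + ∑ W ∈ (Finset.univ : Finset (Finset (Fin n))).filter (fun W => Disjoint W A),
              (prodBernoulli u).real {ω : BondConfig (Fin n) | ∀ z : Fin n, (z ∈ W ↔ ω ∈ ⋃ s ∈ S, openConn s z)}
                * (prodBernoulli u).real (openConnIn ((W : Set (Fin n))ᶜ) (sel W) b)) :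
    Summit.CriticalPhenomena.PercolationContinuityZ3.Theses.PercNearOneGluing.AdditiveGluing := by
  intro n w A o b t ht hA
  have hU1 : (prodBernoulli w).real (⋃ a ∈ A, (openConn o a : Set (BondConfig (Fin n)))) ≤ 1 :=
    measureReal_le_one
  have hob0 : 0 ≤ (prodBernoulli w).real (openConn o b : Set (BondConfig (Fin n))) := measureReal_nonneg
  by_cases ht1 : 1 ≤ t
  · linarith
  push Not at ht1
  -- the level set at level 1 - t
  have hbb : (prodBernoulli w).real (openConn b b : Set (BondConfig (Fin n))) = 1 := by
    have h : (openConn b b : Set (BondConfig (Fin n))) = Set.univ :=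
      Set.eq_univ_of_forall fun ω => (SimpleGraph.Reachable.refl b : (openGraph ω).Reachable b b)
    rw [h, probReal_univ]
  have hbA' : b ∈ Finset.univ.filter (fun x : Fin n => 1 - t ≤ (prodBernoulli w).real (openConn x b)) := by
    rw [Finset.mem_filter]
    refine ⟨Finset.mem_univ _, ?_⟩
    rw [hbb]
    linarith
  have hAA' : ∀ a ∈ A, a ∈ Finset.univ.filter (fun x : Fin n => 1 - t ≤ (prodBernoulli w).real (openConn x b)) :=
    fun a ha => by
      rw [Finset.mem_filter]
      exact ⟨Finset.mem_univ _, hA a ha⟩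
  have hmemA' : ∀ x ∈ Finset.univ.filter (fun x : Fin n => 1 - t ≤ (prodBernoulli w).real (openConn x b)),
      1 - t ≤ (prodBernoulli w).real (openConn x b) := fun x hx => by
    rw [Finset.mem_filter] at hx
    exact hx.2
  by_cases ho : o ∈ Finset.univ.filter (fun x : Fin n => 1 - t ≤ (prodBernoulli w).real (openConn x b))
  · have := hmemA' o ho
    linarith
  -- main case: goodness of the level set, constant selection `b`, penalty dropped
  have hgood := good_of_q9 w _ o b hbA' (q9All_of_residualKernelQ9 hres9 n w
    (Finset.univ.filter (fun x : Fin n => 1 - t ≤ (prodBernoulli w).real (openConn x b))) o b hbA' ho) t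
    (fun _ => b) (fun _ => hbA') hmemA'
  have hsum : 0 ≤ ∑ W ∈ (Finset.univ : Finset (Finset (Fin n))).filter (fun W => o ∈ W ∧
      Disjoint W (Finset.univ.filter (fun x : Fin n => 1 - t ≤ (prodBernoulli w).real (openConn x b)))),
        (prodBernoulli w).real {ω : BondConfig (Fin n) | openCluster ω o = (W : Set (Fin n))}
          * (prodBernoulli w).real (openConnIn ((W : Set (Fin n))ᶜ) ((fun _ => b) W) b)ᶜ :=
    Finset.sum_nonneg fun W _ => mul_nonneg measureReal_nonneg measureReal_nonneg
  have hlive : (prodBernoulli w).real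
      ((⋃ a ∈ Finset.univ.filter (fun x : Fin n => 1 - t ≤ (prodBernoulli w).real (openConn x b)),
        (openConn o a : Set (BondConfig (Fin n)))) ∩ (openConn o b)ᶜ) ≤ t := by
    linarith
  have hsub : (⋃ a ∈ A, (openConn o a : Set (BondConfig (Fin n)))) ⊆
      ((⋃ a ∈ Finset.univ.filter (fun x : Fin n => 1 - t ≤ (prodBernoulli w).real (openConn x b)),
        (openConn o a : Set (BondConfig (Fin n)))) ∩ (openConn o b)ᶜ) ∪ openConn o b := by
    intro ω hω
    by_cases hb : ω ∈ openConn o b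
    · exact Or.inr hb
    · refine Or.inl ⟨?_, hb⟩
      simp only [Set.mem_iUnion] at hω ⊢
      obtain ⟨a, ha, hωa⟩ := hω
      exact ⟨a, hAA' a ha, hωa⟩
  have hfin := (measureReal_mono (μ := prodBernoulli w) hsub).trans (measureReal_union_le _ _)
  linarith



open Filter Literature.Probability.LatticeModels Literature.Probability.Percolation in
/-- Registered helper stub `stub_additiveGluingOfResidualKernelQ9_xfa` (invested seat xfam-a): the crux `AdditiveGluing` BY NAME from the residual
kernel with the Q9 induction hypothesis (= `additiveGluing_of_residualKernelQ9`). [cite: KozmaNitzan2024, §3.2 (Thms 4–5 pp. 12–14), Question 9 (p. 36)] -/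
theorem stub_additiveGluingOfResidualKernelQ9_xfa : (∀ (n : ℕ) (u : Sym2 (Fin n) → unitInterval) (A S : Finset (Fin n)) (b a₀ : Fin n) (sel : Finset (Fin n) → Fin n), b ∈ A → Disjoint S A → 2 ≤ S.card → 4 ≤ A.card → (∀ W, sel W ∈ A) → a₀ ∈ A → (∀ a ∈ A, (prodBernoulli u).real (openConn a₀ b) ≤ (prodBernoulli u).real (openConn a b)) → (∀ v ∈ S, (prodBernoulli u).real (openConn v b) < (prodBernoulli u).real (openConn a₀ b)) → (∃ a ∈ A, (prodBernoulli (fun e : Sym2 (Fin n) => if (∀ x ∈ e, x ∈ S) ∧ ¬ e.IsDiag then 1 else u e)).real (openConn a b) < (prodBernoulli (fun e : Sym2 (Fin n) => if (∀ x ∈ e, x ∈ S) ∧ ¬ e.IsDiag then 1 else u e)).real (openConn a₀ b)) → (∀ w' : Sym2 (Fin n) → unitInterval, (Finset.univ.filter (fun v : Fin n => ∃ z : Fin n, 0 < (w' s(z, v) : ℝ))).card ≤ (Finset.univ.filter (fun v : Fin n => ∃ z : Fin n, 0 < ((fun e : Sym2 (Fin n) => if (∀ x ∈ e, x ∈ S)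 ∧ ¬ e.IsDiag then 1 else u e) s(z, v) : ℝ))).card → ∀ (A' : Finset (Fin n)) (o' b' : Fin n), b' ∈ A' → o' ∉ A' → ∀ c₀ : Fin n, c₀ ∈ A' → (∀ c ∈ A', (prodBernoulli (fun e : Sym2 (Fin n) => if o' ∈ e then (0 : unitInterval) else w' e)).real (openConn c₀ b') ≤ (prodBernoulli (fun e : Sym2 (Fin n) => if o' ∈ e then (0 : unitInterval) else w' e)).real (openConn c b')) → ∀ sel' : Finset (Fin n) → Fin n, (∀ W', sel' W' ∈ A') → (prodBernoulli w').real (openConn c₀ b') ≤ (prodBernoulli w').real (openConn o' b') + ∑ W' ∈ (Finset.univ : Finset (Finset (Fin n))).filter (fun W' => o' ∈ W' ∧ Disjoint W' A'), (prodBernoulli w').real {ω : BondConfig (Fin n) | openCluster ω o' = (W' : Set (Fin n))} * (prodBernoulli w').real (openConnIn ((W' : Set (Fin n))ᶜ) (sel' W') b')) → (prodBernoulli u).real (openConn a₀ b) + (prodBernoulli u).real ((openConn a₀ b)ᶜ ∩ (⋃ s ∈ S, openConn a₀ s) ∩ (⋃ s ∈ S, openConn s b)) ≤ (prodBernoulli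 u).real (⋃ s ∈ S, openConn s b) + ∑ W ∈ (Finset.univ : Finset (Finset (Fin n))).filter (fun W => Disjoint W A), (prodBernoulli u).real {ω : BondConfig (Fin n) | ∀ z : Fin n, (z ∈ W ↔ ω ∈ ⋃ s ∈ S, openConn s z)} * (prodBernoulli u).real (openConnIn ((W : Set (Fin n))ᶜ) (sel W) b)) → Summit.CriticalPhenomena.PercolationContinuityZ3.Theses.PercNearOneGluing.AdditiveGluing :=
  additiveGluing_of_residualKernelQ9

open Filter Literature.Probability.LatticeModels Literature.Probability.Percolation in
/-- Registered helper stub `stub_q9AllOfResidualKernelQ9_xfa` (invested seat xfam-a): Q9 goodness of every quadruple from the residual kernel with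
the Q9 induction hypothesis (= `q9All_of_residualKernelQ9`). [cite: KozmaNitzan2024, §3.2 (Thms 4–5 pp. 12–14), Question 9 (p. 36)] -/
theorem stub_q9AllOfResidualKernelQ9_xfa : (∀ (n : ℕ) (u : Sym2 (Fin n) → unitInterval) (A S : Finset (Fin n)) (b a₀ : Fin n) (sel : Finset (Fin n) → Fin n), b ∈ A → Disjoint S A → 2 ≤ S.card → 4 ≤ A.card → (∀ W, sel W ∈ A) → a₀ ∈ A → (∀ a ∈ A, (prodBernoulli u).real (openConn a₀ b) ≤ (prodBernoulli u).real (openConn a b)) → (∀ v ∈ S, (prodBernoulli u).real (openConn v b) < (prodBernoulli u).real (openConn a₀ b)) → (∃ a ∈ A, (prodBernoulli (fun e : Sym2 (Fin n) => if (∀ x ∈ e, x ∈ S) ∧ ¬ e.IsDiag then 1 else u e)).real (openConn a b) < (prodBernoulli (fun e : Sym2 (Fin n) => if (∀ x ∈ e, x ∈ S) ∧ ¬ e.IsDiag then 1 else u e)).real (openConn a₀ b)) → (∀ w' : Sym2 (Fin n) → unitInterval, (Finset.univ.filter (fun v : Fin n => ∃ z : Fin n, 0 < (w' s(z, v) : ℝ))).card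 ≤ (Finset.univ.filter (fun v : Fin n => ∃ z : Fin n, 0 < ((fun e : Sym2 (Fin n) => if (∀ x ∈ e, x ∈ S) ∧ ¬ e.IsDiag then 1 else u e) s(z, v) : ℝ))).card → ∀ (A' : Finset (Fin n)) (o' b' : Fin n), b' ∈ A' → o' ∉ A' → ∀ c₀ : Fin n, c₀ ∈ A' → (∀ c ∈ A', (prodBernoulli (fun e : Sym2 (Fin n) => if o' ∈ e then (0 : unitInterval) else w' e)).real (openConn c₀ b') ≤ (prodBernoulli (fun e : Sym2 (Fin n) => if o' ∈ e then (0 : unitInterval) else w' e)).real (openConn c b')) → ∀ sel' : Finset (Fin n) → Fin n, (∀ W', sel' W' ∈ A') → (prodBernoulli w').real (openConn c₀ b') ≤ (prodBernoulli w').real (openConn o' b') + ∑ W' ∈ (Finset.univ : Finset (Finset (Fin n))).filter (fun W' => o' ∈ W' ∧ Disjoint W' A'), (prodBernoulli w').real {ω : BondConfig (Fin n) | openCluster ω o' = (W' : Set (Fin n))} * (prodBernoulli w').real (openConnIn ((W' : Set (Fin n))ᶜ) (sel' W') b')) → (prodBernoulli u).real (openConn a₀ b) + (prodBernoulli u).real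 ((openConn a₀ b)ᶜ ∩ (⋃ s ∈ S, openConn a₀ s) ∩ (⋃ s ∈ S, openConn s b)) ≤ (prodBernoulli u).real (⋃ s ∈ S, openConn s b) + ∑ W ∈ (Finset.univ : Finset (Finset (Fin n))).filter (fun W => Disjoint W A), (prodBernoulli u).real {ω : BondConfig (Fin n) | ∀ z : Fin n, (z ∈ W ↔ ω ∈ ⋃ s ∈ S, openConn s z)} * (prodBernoulli u).real (openConnIn ((W : Set (Fin n))ᶜ) (sel W) b)) → ∀ (n : ℕ) (w : Sym2 (Fin n) → unitInterval) (A : Finset (Fin n)) (o b : Fin n), b ∈ A → o ∉ A → ∀ a₀ : Fin n, a₀ ∈ A → (∀ a ∈ A, (prodBernoulli (fun e : Sym2 (Fin n) => if o ∈ e then (0 : unitInterval) else w e)).real (openConn a₀ b) ≤ (prodBernoulli (fun e : Sym2 (Fin n) => if o ∈ e then (0 : unitInterval) else w e)).real (openConn a b)) → ∀ sel : Finset (Fin n) → Fin n, (∀ W, sel W ∈ A) → (prodBernoulli w).real (openConn a₀ b) ≤ (prodBernoulli w).real (openConn o b) + ∑ W ∈ (Finset.univ : Finset (Finset (Fin n))).filter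 (fun W => o ∈ W ∧ Disjoint W A), (prodBernoulli w).real {ω : BondConfig (Fin n) | openCluster ω o = (W : Set (Fin n))} * (prodBernoulli w).real (openConnIn ((W : Set (Fin n))ᶜ) (sel W) b) :=
  q9All_of_residualKernelQ9

end

end Summit.CriticalPhenomena.PercolationContinuityZ3.Theorems
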